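import Literature.Computability.QuantumComplexity.GRBlockWord
import Literature.Computability.QuantumComplexity.ProdStateDistance
import Literature.Computability.QuantumComplexity.WordCircuit
import HarnessLib

/-!
# The Grover–Rudolph stage: the block on every coordinate register, a product state

Topic `Literature/Computability/QuantumComplexity`; sequel of `GRBlockWord.lean`. Regev's sampler
(Lemma 3.14 via Lemma 3.12: "Repeating the procedure described above `n` times creates … the `n`-fold
tensor product") runs the Grover–Rudolph block on each of the `n` coordinate registers. With the blocks
self-contained on `B` wires (point register, work window and gadget kit) and transported along
pairwise disjoint embeddings `E i : Fin B ↪ Fin W` (`CircuitEmbedding.lean`), the stage maps the clean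
basis state to the PRODUCT of the blocks' outputs (`toMatrix_flatMap_mapWires_mulVec_prodState`), and
the distance to a product of target states is at most the sum of the blocks' distances
(`l2Norm_prodState_sub_prodState_le`):

* `GRStage.levelCircuit`, `blockCircuit` (`toMatrix_blockCircuit = Π stepMat`), `stageCircuit`;
* `GRStage.block_output_sub_le` — one block: `‖U_blk |x₀⟩ − χ‖ ≤ ℓ·grErr k + η` from
  `GRBlock.Data.prod_steps_implOn` and a bound `η` on the ideal product's distance to `χ`;
* **`GRStage.stage_output_sub_prodState_le`** — `‖U_stage |c⟩ − ⨂ᵢ χᵢ‖ ≤ Σᵢ (ℓ·grErr k + ηᵢ)`.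

Everything here is proved; definitions have bodies; no named fact is introduced.

## References

* O. Regev, J. ACM 56 (2009), art. 34, Lemma 3.12 (proof), Lemma 3.14 (proof) [Regev2009].
* M. A. Nielsen, I. L. Chuang, *Quantum Computation and Quantum Information*, CUP 2010, §2.1.7, Box 4.1 [NielsenChuang2010].
-/

noncomputable section

namespace Literature.Computability.QuantumComplexity

open _root_.Matrix Finset Cryptography GroverRudolph GRWord

namespace GRStage

variable {B ℓ np : ℕ} {kit : GadgetKit B} {ws : Fin ℓ ↪ Fin B} {pw : Fin np ↪ Fin B} {a : Fin ℓ → (Fin ℓ → Bool) → ℝ} (D : GRBlock.Data kit ws pw a)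

/-- **The circuit of level `j`**: compute, rotate, uncompute. [cite: Regev2009, Lemma 3.12 (proof)] -/
def levelCircuit (j : Fin ℓ) : QCircuit cliffordT B :=
  chainCircuit [CleanPlaced.circuitRev (D.hG j).geom (hN := kit.hN), grWord D.hk (D.hW j) D.hP, CleanPlaced.circuit (D.hG j).geom (hN := kit.hN)]

/-- Its matrix is the level step. [folklore] -/
theorem toMatrix_levelCircuit (j : Fin ℓ) : (levelCircuit D j).toMatrix 0 = D.stepMat j := by
  rw [levelCircuit, toMatrix_chainCircuit, List.map_cons, List.map_cons, List.map_cons, List.map_nil, List.prod_cons, List.prod_cons,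
    List.prod_cons, List.prod_nil, Matrix.mul_one, GRBlock.Data.stepMat, Matrix.mul_assoc]

/-- **The block circuit**: all levels (level `0` first). [cite: Regev2009, Lemma 3.12 (proof)] -/
def blockCircuit : QCircuit cliffordT B := chainCircuit ((List.ofFn (levelCircuit D)).reverse)

/-- Its matrix is the product of the level steps. [folklore] -/
theorem toMatrix_blockCircuit : (blockCircuit D).toMatrix 0 = (D.steps.map ApproxStep.act).prod := by
  rw [blockCircuit, toMatrix_chainCircuit, GRBlock.Data.steps_map_act, List.map_reverse, List.map_ofFn]
  congr 2
  exact List.ofFn_inj.2 (funext fun j => toMatrix_levelCircuit D j)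

/-- A basis state is a unit vector. [folklore] -/
theorem l2Norm_basisState' (x : QReg B) : l2Norm (basisState x) = 1 := by
  rw [l2Norm_eq_sqrt_normSq, normSq_basisState, Real.sqrt_one]

/-- **One block on a clean label**: `‖U_blk |x₀⟩ − χ‖ ≤ ℓ·grErr k + η` whenever the ideal product is
`η`-close to `χ` on `|x₀⟩`. [cite: Regev2009, Lemma 3.12 (proof)] -/
theorem block_output_sub_le {x₀ : QReg B} (hx₀ : x₀ ∈ D.P) (χ : QReg B → ℂ) {η : ℝ}
    (hη : l2Norm ((List.ofFn fun j => genLevelGate ws (GRBlock.R a) j).reverse.prod *ᵥ basisState x₀ - χ) ≤ η) :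
    l2Norm ((blockCircuit D).toMatrix 0 *ᵥ basisState x₀ - χ) ≤ ℓ * grErr kit.k + η := by
  have h1 := D.prod_steps_implOn (basisState x₀) (suppIn_basisState hx₀)
  rw [l2Norm_basisState', mul_one, ← toMatrix_blockCircuit] at h1
  exact (l2Norm_sub_le _ ((List.ofFn fun j => genLevelGate ws (GRBlock.R a) j).reverse.prod *ᵥ basisState x₀) _).trans (add_le_add h1 hη)

/-! ### The stage -/

variable {n W : ℕ} (E : Fin n → (Fin B ↪ Fin W))

/-- **The stage circuit**: the block transported to every coordinate register. [cite: Regev2009, Lemma 3.14 (proof)] -/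
def stageCircuit : QCircuit cliffordT W := ⟨(List.finRange n).flatMap fun i => (mapWires (E i) (blockCircuit D)).gates⟩

variable {E}

/-- **The stage on a clean basis state is the product of the blocks' outputs.** [cite: NielsenChuang2010, §2.1.7] -/
theorem stageCircuit_mulVec_basisState (hE : BlockDisjoint E) (c : QReg W) :
    (stageCircuit D E).toMatrix 0 *ᵥ basisState c = prodState E (fun i => (blockCircuit D).toMatrix 0 *ᵥ basisState (c ∘ E i)) c := by
  rw [basisState_eq_prodState E c, stageCircuit, toMatrix_flatMap_mapWires_mulVec_prodState 0 hE]

/-- The block circuit is unitary, so its outputs are unit vectors. [folklore] -/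
theorem l2Norm_block_output (x : QReg B) : l2Norm ((blockCircuit D).toMatrix 0 *ᵥ basisState x) = 1 := by
  rw [l2Norm_mulVec_of_mem_unitaryGroup (QCircuit.toMatrix_mem_unitaryGroup_holds cliffordT_isUnitary_holds 0 _), l2Norm_basisState']

/-- **The Grover–Rudolph stage prepares the product of the target states up to the sum of the blocks'
errors**: `‖U_stage |c⟩ − ⨂ᵢ χᵢ‖ ≤ Σᵢ (ℓ·grErr k + ηᵢ)` for block contents `c ∘ E i ∈ D.P` and unit-or-less
targets `χᵢ` with `‖(Π genLevelGate) |c ∘ E i⟩ − χᵢ‖ ≤ ηᵢ`.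
[cite: Regev2009, Lemma 3.12 (proof) and Lemma 3.14 (proof)] [cite: NielsenChuang2010, Box 4.1] -/
theorem stage_output_sub_prodState_le (hE : BlockDisjoint E) (c : QReg W) (hc : ∀ i, c ∘ E i ∈ D.P) (χ : Fin n → QReg B → ℂ)
    (hχ : ∀ i, l2Norm (χ i) ≤ 1) {η : Fin n → ℝ}
    (hη : ∀ i, l2Norm ((List.ofFn fun j => genLevelGate ws (GRBlock.R a) j).reverse.prod *ᵥ basisState (c ∘ E i) - χ i) ≤ η i) :
    l2Norm ((stageCircuit D E).toMatrix 0 *ᵥ basisState c - prodState E χ c) ≤ ∑ i, (ℓ * grErr kit.k + η i) := by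
  rw [stageCircuit_mulVec_basisState D hE c]
  refine (l2Norm_prodState_sub_prodState_le hE (fun i => (l2Norm_block_output D _).le) hχ c).trans ?_
  exact sum_le_sum fun i _ => block_output_sub_le D (hc i) (χ i) (hη i)

end GRStage

end Literature.Computability.QuantumComplexity

end
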